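import Mathlib.RingTheory.SimpleModule.Basic
import Mathlib.RingTheory.Ideal.Quotient.Basic
import Mathlib.SetTheory.Cardinal.Finite
import Mathlib.GroupTheory.Index
import HarnessLib

/-!
# A module killed by a maximal ideal with at most `#(𝒪⧸𝔪)` elements has no proper non-zero submodule

Topic `Literature/Algebra/Module`; namespace `Literature.Algebra.Module`.  THEOREMS ONLY (no definition, no named fact, no instance,
no notation, no `sorry`); Mathlib-only imports.  Cell `hodgecm-mathlib` (D-0151), FLOOR 0, P6 «MOD programme» (crux hLiu418 =
stmt-HodgeConjecture-24832), generic algebra organ **(H1-alg)** for the HEART letter (b) `eq_kerF_or_isEtale` of the isogeny dictionary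
(CENSUS-DICT v3 §(F.1), desk F0P6c-plan): «`H(κ̄)` is an `𝒪`-submodule of the SIMPLE `𝒢_x̄[𝔴](κ̄) ≅ 𝒪⁄𝔴`, so `#H(κ̄) ∈ {1, q}` — the middle
case `1 < #H(κ̄) < q` is excluded by `𝒪`-stability».  HC_CM is proved only modulo the printed citations until rung 0 closes; this file is
generic algebra and changes no count.

THE PRINT (folklore linear algebra): [AtiyahMacdonald1969] Ch. 2, p. 19 «If `Ann(M) ⊇ 𝔞`, we may regard `M` as an `A⁄𝔞`-module» and
p. 22 «`M⁄𝔪M` is annihilated by `𝔪`, hence is naturally an `A⁄𝔪`-module, i.e. a `k`-vector space»; a `k`-vector space with at most `#k`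
elements has dimension `≤ 1`, hence no proper non-zero subspace.  Let `𝒪` be a commutative ring, `𝔪` a maximal ideal
with FINITE residue field `k = 𝒪⁄𝔪` (`q` elements), and `P` an `𝒪`-module killed by `𝔪`.  For `x ∈ P`, `x ≠ 0`, the orbit map
`𝒪⁄𝔪 → P`, `a ↦ a·x`, is an INJECTIVE `𝒪`-linear map (its source is a simple `𝒪`-module), so every non-zero submodule `N ∋ x` has
`#N ≥ q`; if `#P ≤ q` this forces `N = P`: **every `𝒪`-submodule of `P` is `0` or `P`**, and `P` itself is `0` or has exactly `q` elements.

* `smul_eq_smul_of_sub_mem` — `a − b ∈ 𝔪 ⇒ a·x = b·x` (the action factors through `𝒪⁄𝔪`).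
* `card_quotient_le_card_of_ne_bot` — a non-zero submodule has at least `#(𝒪⁄𝔪)` elements.
* **`eq_bot_or_eq_top_of_card_le`** — `#P ≤ #(𝒪⁄𝔪)` ⇒ every submodule is `⊥` or `⊤`.
* `subsingleton_or_card_eq_of_card_le` — `#P ≤ #(𝒪⁄𝔪)` ⇒ `P = 0` or `#P = #(𝒪⁄𝔪)`.
* `card_eq_one_or_card_eq_of_card_le` — the same for a submodule `N`: `#N = 1` or `#N = #(𝒪⁄𝔪)` (then `N = ⊤`).
* `addSubgroup_eq_bot_or_eq_top_of_card_le` (+ primed form for a set of endomorphisms) — the `AddSubgroup` shape in which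
  «`𝒪`-stable subgroups of the group of points» arrive.

## References
* [AtiyahMacdonald1969] M. F. Atiyah, I. G. Macdonald, *Introduction to Commutative Algebra* (1969), Ch. 2 (p. 19: modules over `A⁄𝔞`;
  p. 22: `M⁄𝔪M` as a `k`-vector space).
-/

set_option autoImplicit false

namespace Literature.Algebra.Module

universe u v

variable {𝒪 : Type u} [CommRing 𝒪] (𝔪 : Ideal 𝒪) [𝔪.IsMaximal] {P : Type v} [AddCommGroup P] [_root_.Module 𝒪 P]

omit [𝔪.IsMaximal] in
/-- If `𝔪` kills `P`, the action of `a ∈ 𝒪` on `P` depends only on `a mod 𝔪`. [cite: AtiyahMacdonald1969, Ch. 2 (p. 19) and (p. 22)] -/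
theorem smul_eq_smul_of_sub_mem (h𝔪 : ∀ a ∈ 𝔪, ∀ x : P, a • x = 0) {a b : 𝒪} (hab : a - b ∈ 𝔪) (x : P) :
    a • x = b • x := by
  have h := h𝔪 (a - b) hab x
  rwa [sub_smul, sub_eq_zero] at h

/-- **The orbit map `𝒪⁄𝔪 → P`, `a ↦ a·x`, is injective for `x ≠ 0`** (as an `𝒪`-linear map out of the simple module `𝒪⁄𝔪` it is
injective or zero, Mathlib `LinearMap.injective_or_eq_zero`); hence a submodule containing a non-zero element has at least `#(𝒪⁄𝔪)`
elements. [cite: AtiyahMacdonald1969, Ch. 2 (p. 19) and (p. 22)] -/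
theorem card_quotient_le_card_of_ne_bot [Finite P] (h𝔪 : ∀ a ∈ 𝔪, ∀ x : P, a • x = 0) (N : Submodule 𝒪 P) (hN : N ≠ ⊥) :
    Nat.card (𝒪 ⧸ 𝔪) ≤ Nat.card N := by
  obtain ⟨x, hxN, hx0⟩ := (Submodule.ne_bot_iff N).mp hN
  -- the orbit map `𝒪 → N`, `a ↦ a • x`, kills `𝔪`
  let f : 𝒪 →ₗ[𝒪] N := LinearMap.codRestrict N (LinearMap.toSpanSingleton 𝒪 P x) (fun a => N.smul_mem a hxN)
  have hf : 𝔪 ≤ LinearMap.ker f := by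
    intro a ha
    rw [LinearMap.mem_ker]
    apply Subtype.ext
    change a • x = 0
    exact h𝔪 a ha x
  let ψ : (𝒪 ⧸ 𝔪) →ₗ[𝒪] N := Submodule.liftQ 𝔪 f hf
  haveI : IsSimpleModule 𝒪 (𝒪 ⧸ 𝔪) := isSimpleModule_iff_quot_maximal.mpr ⟨𝔪, inferInstance, ⟨LinearEquiv.refl 𝒪 _⟩⟩
  have hψ : Function.Injective ψ := by
    rcases LinearMap.injective_or_eq_zero ψ with h | h
    · exact h
    · exfalso
      apply hx0
      have h1 : ψ (Submodule.Quotient.mk 1) = 0 := by rw [h, LinearMap.zero_apply]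
      have h2 : (ψ (Submodule.Quotient.mk 1) : P) = (1 : 𝒪) • x := rfl
      rw [h1, one_smul] at h2
      exact h2.symm ▸ rfl
  haveI : Finite N := Finite.of_injective (fun y : N => (y : P)) Subtype.val_injective
  exact Nat.card_le_card_of_injective ψ hψ

/-- **EVERY SUBMODULE IS `⊥` OR `⊤`** when `P` is killed by the maximal ideal `𝔪` and `#P ≤ #(𝒪⁄𝔪)` (finite residue field; e.g. `P` the
`κ̄`-points of `𝒢_x̄[𝔴]`, `#P ≤ q`, with its `𝒪_{F,𝔴}`-action): a non-zero submodule has `≥ #(𝒪⁄𝔪) ≥ #P` elements.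
[cite: AtiyahMacdonald1969, Ch. 2 (p. 19) and (p. 22)] -/
theorem eq_bot_or_eq_top_of_card_le [Finite P] (h𝔪 : ∀ a ∈ 𝔪, ∀ x : P, a • x = 0) (hcard : Nat.card P ≤ Nat.card (𝒪 ⧸ 𝔪))
    (N : Submodule 𝒪 P) : N = ⊥ ∨ N = ⊤ := by
  by_cases hN : N = ⊥
  · exact Or.inl hN
  · right
    have h1 := card_quotient_le_card_of_ne_bot 𝔪 h𝔪 N hN
    have h2 : Nat.card N ≤ Nat.card P := Nat.card_le_card_of_injective (fun y : N => (y : P)) Subtype.val_injective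
    have hc : Nat.card N.toAddSubgroup = Nat.card P := le_antisymm h2 (hcard.trans h1)
    have htop : N.toAddSubgroup = ⊤ := AddSubgroup.eq_top_of_card_eq _ hc
    exact Submodule.toAddSubgroup_injective (htop.trans Submodule.top_toAddSubgroup.symm)

/-- `#P ≤ #(𝒪⁄𝔪)` and `𝔪·P = 0` ⟹ `P = 0` or `#P = #(𝒪⁄𝔪)`. [cite: AtiyahMacdonald1969, Ch. 2 (p. 19) and (p. 22)] -/
theorem subsingleton_or_card_eq_of_card_le [Finite P] (h𝔪 : ∀ a ∈ 𝔪, ∀ x : P, a • x = 0)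
    (hcard : Nat.card P ≤ Nat.card (𝒪 ⧸ 𝔪)) : Subsingleton P ∨ Nat.card P = Nat.card (𝒪 ⧸ 𝔪) := by
  by_cases htop : (⊤ : Submodule 𝒪 P) = ⊥
  · left
    exact subsingleton_of_forall_eq 0 fun x => (Submodule.mem_bot 𝒪).mp (htop ▸ Submodule.mem_top : x ∈ (⊥ : Submodule 𝒪 P))
  · right
    have h1 := card_quotient_le_card_of_ne_bot 𝔪 h𝔪 ⊤ htop
    have h2 : Nat.card (⊤ : Submodule 𝒪 P) = Nat.card P := Nat.card_congr Submodule.topEquiv.toEquiv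
    rw [h2] at h1
    exact le_antisymm hcard h1

/-- Submodule form: `#P ≤ #(𝒪⁄𝔪)` and `𝔪·P = 0` ⟹ every submodule `N` has `#N = 1` (and `N = ⊥`) or `#N = #(𝒪⁄𝔪)` (and `N = ⊤`).
[cite: AtiyahMacdonald1969, Ch. 2 (p. 19) and (p. 22)] -/
theorem card_eq_one_or_card_eq_of_card_le [Finite P] (h𝔪 : ∀ a ∈ 𝔪, ∀ x : P, a • x = 0)
    (hcard : Nat.card P ≤ Nat.card (𝒪 ⧸ 𝔪)) (N : Submodule 𝒪 P) :
    (N = ⊥ ∧ Nat.card N = 1) ∨ (N = ⊤ ∧ Nat.card N = Nat.card (𝒪 ⧸ 𝔪)) := by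
  rcases eq_bot_or_eq_top_of_card_le 𝔪 h𝔪 hcard N with h | h
  · left
    refine ⟨h, ?_⟩
    subst h
    exact Nat.card_unique
  · subst h
    rcases subsingleton_or_card_eq_of_card_le 𝔪 h𝔪 hcard with hs | hc
    · left
      haveI := hs
      haveI : Subsingleton (⊤ : Submodule 𝒪 P) := ⟨fun a b => Subtype.ext (Subsingleton.elim _ _)⟩
      refine ⟨?_, Nat.card_of_subsingleton (⟨0, Submodule.mem_top⟩ : (⊤ : Submodule 𝒪 P))⟩
      exact Submodule.eq_bot_iff _ |>.mpr fun x _ => Subsingleton.elim _ _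
    · right
      exact ⟨rfl, (Nat.card_congr Submodule.topEquiv.toEquiv).trans hc⟩

/-- **`AddSubgroup` form** (the shape in which «`𝒪`-stable subgroups of the group of points» arrive): an additive subgroup `N` of `P`
stable under the action (`a • N ⊆ N` for all `a ∈ 𝒪`) is `⊥` or `⊤` as soon as `𝔪·P = 0` and `#P ≤ #(𝒪⁄𝔪)`.
[cite: AtiyahMacdonald1969, Ch. 2 (p. 19) and (p. 22)] -/
theorem addSubgroup_eq_bot_or_eq_top_of_card_le [Finite P] (h𝔪 : ∀ a ∈ 𝔪, ∀ x : P, a • x = 0)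
    (hcard : Nat.card P ≤ Nat.card (𝒪 ⧸ 𝔪)) (N : AddSubgroup P) (hN : ∀ (a : 𝒪) (x : P), x ∈ N → a • x ∈ N) :
    N = ⊥ ∨ N = ⊤ := by
  let N' : Submodule 𝒪 P := { N with smul_mem' := fun a x hx => hN a x hx }
  have hN' : N'.toAddSubgroup = N := rfl
  rcases eq_bot_or_eq_top_of_card_le 𝔪 h𝔪 hcard N' with h | h
  · left
    rw [← hN', h, Submodule.bot_toAddSubgroup]
  · right
    rw [← hN', h, Submodule.top_toAddSubgroup]

/-- The same for a set `E` of additive endomorphisms through which `𝒪` acts: if every `a ∈ 𝒪` acts as some `e ∈ E` (e.g. `E` = the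
image of a ring action `𝒪 → End P`), an `E`-stable additive subgroup is `⊥` or `⊤`. [cite: AtiyahMacdonald1969, Ch. 2 (p. 19) and (p. 22)] -/
theorem addSubgroup_eq_bot_or_eq_top_of_card_le' [Finite P] (h𝔪 : ∀ a ∈ 𝔪, ∀ x : P, a • x = 0)
    (hcard : Nat.card P ≤ Nat.card (𝒪 ⧸ 𝔪)) (E : Set (P →+ P)) (hE : ∀ a : 𝒪, ∃ e ∈ E, ∀ x : P, e x = a • x)
    (N : AddSubgroup P) (hN : ∀ e ∈ E, ∀ x ∈ N, e x ∈ N) : N = ⊥ ∨ N = ⊤ := by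
  refine addSubgroup_eq_bot_or_eq_top_of_card_le 𝔪 h𝔪 hcard N fun a x hx => ?_
  obtain ⟨e, heE, he⟩ := hE a
  rw [← he x]
  exact hN e heE x hx

end Literature.Algebra.Module
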